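import Mathlib

/-!
# T4RealPlace — the Hilbert symbol and the local norms at a REAL place (sub-claim B1, facts (N2)/(N3) at τ ∈ Φ_{F⁺})

Cell pub-hodge-repro2, Tier 4, sub-claim B1 (route/T4-B1-p3.md, owner p3). Lemmas B1.2.5 and B1.4.1 use, at each
real place τ of F⁺ (where F ⊗_{F⁺,τ} ℝ ≅ ℂ and θ < 0), three elementary facts about the real Hilbert symbol as
DEFINED by O'Meara (Introduction to Quadratic Forms, §63B, p. 168: `(α,β/𝔭) = +1` iff `αξ² + βη² = 1` is solvable
in the complete field, else `−1`) and about the norms from ℂ to ℝ: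

* (R1) for θ < 0 the equation `αξ² + θη² = 1` is solvable in ℝ iff `α > 0` — so `(α, θ)_τ = −1 ⟺ τ(α) < 0`
  (Lemma B1.4.1: the τ-nearby space `diag(1,1,α)` has `τ(α) < 0`, i.e. signature (2,1), exactly when the symbol at τ is −1);
* (R2) `(−1, θ)_τ = −1` for θ < 0 (the idèle `j` with `j_{τ₀} = −1` in the proof of Lemma B1.2.5);
* (R3) the non-zero norms from ℂ = `{ z·z̄ : z ≠ 0 } = { |z|² }` are exactly the positive reals, so (R1) says
  «α is a local norm at τ iff `(α, θ)_τ = 1`» — O'Meara's (N2) at a real spot, checked directly.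

Everything here is real analysis over ℝ/ℂ; nothing adelic. The Hilbert symbol at a FINITE place and Hilbert
reciprocity stay printed (O'Meara 63:12, 65:21, 71:18 — the `LocalSymbols` model of T4GroupData.lean takes them as
hypotheses). Mathlib v4.32.0 only; no Literature/ module.
-/

namespace Summit.Ventures.HodgeRepro2.T4RealPlace

open Complex

/-- O'Meara's solvability condition defining the Hilbert symbol at a real spot (§63B, p. 168, ll. 22–27):
`(α, β / 𝔭) = +1` iff `α ξ² + β η² = 1` has a solution `(ξ, η)` in the complete field, here ℝ. -/
def RealHilbertSolvable (α β : ℝ) : Prop :=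
  ∃ ξ η : ℝ, α * ξ ^ 2 + β * η ^ 2 = 1

open Classical in
/-- The real Hilbert symbol `(α, β)_∞ ∈ {±1}`, as an element of `ℤˣ`: `1` if `α ξ² + β η² = 1` is solvable in ℝ,
`−1` otherwise (O'Meara §63B; classical choice of the truth value). -/
noncomputable def realHilbertSymbol (α β : ℝ) : ℤˣ :=
  if RealHilbertSolvable α β then 1 else -1

/-- If `0 < α`, then `α ξ² + β η² = 1` is solvable: take `ξ = 1/√α`, `η = 0`. -/
theorem realHilbertSolvable_of_pos_left {α : ℝ} (β : ℝ) (hα : 0 < α) : RealHilbertSolvable α β := by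
  refine ⟨1 / Real.sqrt α, 0, ?_⟩
  have hs : Real.sqrt α ^ 2 = α := Real.sq_sqrt hα.le
  have hs0 : Real.sqrt α ≠ 0 := (Real.sqrt_pos.mpr hα).ne'
  rw [div_pow, hs, one_pow, mul_one_div_cancel hα.ne']
  ring

/-- If `0 < β`, then `α ξ² + β η² = 1` is solvable: take `ξ = 0`, `η = 1/√β`. -/
theorem realHilbertSolvable_of_pos_right (α : ℝ) {β : ℝ} (hβ : 0 < β) : RealHilbertSolvable α β := by
  obtain ⟨ξ, η, h⟩ := realHilbertSolvable_of_pos_left α hβ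
  exact ⟨η, ξ, by linarith⟩

/-- If `α ≤ 0` and `β ≤ 0`, then `α ξ² + β η² ≤ 0 < 1` for all real `ξ, η`: the equation is not solvable. -/
theorem not_realHilbertSolvable_of_nonpos {α β : ℝ} (hα : α ≤ 0) (hβ : β ≤ 0) :
    ¬ RealHilbertSolvable α β := by
  rintro ⟨ξ, η, h⟩
  have h1 : α * ξ ^ 2 ≤ 0 := mul_nonpos_of_nonpos_of_nonneg hα (sq_nonneg ξ)
  have h2 : β * η ^ 2 ≤ 0 := mul_nonpos_of_nonpos_of_nonneg hβ (sq_nonneg η)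
  linarith

/-- (R1) For `θ < 0` (θ the non-square with `F = F⁺(√θ)`, negative at every real place of a CM field):
`α ξ² + θ η² = 1` is solvable in ℝ iff `0 < α`. Hence `(α, θ)_τ = −1 ⟺ τ(α) < 0` for `α ≠ 0` —
the real-place clause of Lemma B1.4.1 (signature (2,1) at τ ⟺ symbol −1 at τ). -/
theorem realHilbertSolvable_iff_of_neg {α θ : ℝ} (hθ : θ < 0) :
    RealHilbertSolvable α θ ↔ 0 < α := by
  constructor
  · intro h
    by_contra hα
    exact not_realHilbertSolvable_of_nonpos (not_lt.mp hα) hθ.le h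
  · intro hα
    exact realHilbertSolvable_of_pos_left θ hα

/-- (R2) For `θ < 0`, the equation `−ξ² + θ η² = 1` has no real solution: `(−1, θ)_τ = −1`
(the idèle `j` with `j_{τ₀} = −1` in the proof of Lemma B1.2.5 is not in `F⁺^× N(A_F^×)`). -/
theorem not_realHilbertSolvable_neg_one {θ : ℝ} (hθ : θ < 0) : ¬ RealHilbertSolvable (-1) θ :=
  not_realHilbertSolvable_of_nonpos (by norm_num) hθ.le

/-- The real Hilbert symbol of `(α, θ)` with `θ < 0` and `α ≠ 0` is `−1` iff `α < 0`. -/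
theorem realHilbertSymbol_eq_neg_one_iff {α θ : ℝ} (hθ : θ < 0) (hα : α ≠ 0) :
    realHilbertSymbol α θ = -1 ↔ α < 0 := by
  rcases lt_or_gt_of_ne hα with h | h
  · have : ¬ RealHilbertSolvable α θ := by
      rw [realHilbertSolvable_iff_of_neg hθ]; exact not_lt.mpr h.le
    rw [realHilbertSymbol, if_neg this]
    exact iff_of_true rfl h
  · have : RealHilbertSolvable α θ := (realHilbertSolvable_iff_of_neg hθ).mpr h
    rw [realHilbertSymbol, if_pos this]
    exact iff_of_false (by decide) (not_lt.mpr h.le)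

/-- The real Hilbert symbol of `(α, θ)` with `θ < 0` is `1` iff `0 < α`. -/
theorem realHilbertSymbol_eq_one_iff {α θ : ℝ} (hθ : θ < 0) :
    realHilbertSymbol α θ = 1 ↔ 0 < α := by
  rw [← realHilbertSolvable_iff_of_neg hθ]
  by_cases h : RealHilbertSolvable α θ
  · rw [realHilbertSymbol, if_pos h]
    exact iff_of_true rfl h
  · rw [realHilbertSymbol, if_neg h]
    exact iff_of_false (by decide) h

/-- The real Hilbert symbol is symmetric: `(α, β)_∞ = (β, α)_∞` (swap `ξ` and `η`). -/
theorem realHilbertSolvable_comm (α β : ℝ) : RealHilbertSolvable α β ↔ RealHilbertSolvable β α := by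
  constructor <;> rintro ⟨ξ, η, h⟩ <;> exact ⟨η, ξ, by linarith⟩

/-- (R3a) Every positive real is a norm from ℂ: `r = |z|² = z·z̄` with `z = √r`. -/
theorem exists_normSq_eq_of_pos {r : ℝ} (hr : 0 < r) : ∃ z : ℂ, z ≠ 0 ∧ Complex.normSq z = r := by
  refine ⟨(Real.sqrt r : ℂ), ?_, ?_⟩
  · exact_mod_cast (Real.sqrt_pos.mpr hr).ne'
  · rw [Complex.normSq_ofReal, Real.mul_self_sqrt hr.le]

/-- (R3b) A norm `z·z̄ = |z|²` of a non-zero complex number is positive. -/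
theorem normSq_pos_of_ne_zero {z : ℂ} (hz : z ≠ 0) : 0 < Complex.normSq z :=
  Complex.normSq_pos.mpr hz

/-- (R3) The non-zero local norms at a real place of `F⁺` (norms from `F ⊗_{F⁺,τ} ℝ ≅ ℂ`) are exactly the
positive reals: `∃ z ≠ 0, |z|² = r ⟺ 0 < r`. -/
theorem exists_ne_zero_normSq_eq_iff (r : ℝ) : (∃ z : ℂ, z ≠ 0 ∧ Complex.normSq z = r) ↔ 0 < r := by
  constructor
  · rintro ⟨z, hz, rfl⟩
    exact normSq_pos_of_ne_zero hz
  · exact exists_normSq_eq_of_pos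

/-- `−1` is not a norm from ℂ (no `z` with `|z|² = −1`): the real-place input of Lemma B1.2.5. -/
theorem normSq_ne_neg_one (z : ℂ) : Complex.normSq z ≠ -1 := by
  have := Complex.normSq_nonneg z
  linarith

/-- O'Meara's (N2) at a real spot with `θ < 0`, verified directly: `α` is a local norm at `τ`
(`α = |z|²` for some `z ≠ 0`) iff `(α, θ)_τ = 1`, i.e. iff `α ξ² + θ η² = 1` is solvable. -/
theorem realHilbertSolvable_iff_isNorm {α θ : ℝ} (hθ : θ < 0) :
    RealHilbertSolvable α θ ↔ ∃ z : ℂ, z ≠ 0 ∧ Complex.normSq z = α := by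
  rw [realHilbertSolvable_iff_of_neg hθ, exists_ne_zero_normSq_eq_iff]

/-- The product of the real symbols at two real places `τ, τ′` where `α` has opposite signs is `−1`, and
it is `+1` where `α` has the same sign twice: the real part of the parity count `φ(D) = (−1)^{|T|}` of
Lemma B1.2.5 — a symbol `−1` at τ is exactly one negative coordinate. -/
theorem realHilbertSymbol_mul_of_sign {α α' θ θ' : ℝ} (hθ : θ < 0) (hθ' : θ' < 0)
    (hα : 0 < α) (hα' : α' < 0) : realHilbertSymbol α θ * realHilbertSymbol α' θ' = -1 := by
  rw [(realHilbertSymbol_eq_one_iff hθ).mpr hα, (realHilbertSymbol_eq_neg_one_iff hθ' hα'.ne).mpr hα']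
  simp

/-- The idèle `j = (−1 at τ₀, 1 elsewhere)` of Lemma B1.2.5, real part: its symbol at `τ₀` is `−1` and its symbol
at every other real place (coordinate `1`) is `+1`. -/
theorem realHilbertSymbol_one_eq_one {θ : ℝ} (hθ : θ < 0) : realHilbertSymbol 1 θ = 1 :=
  (realHilbertSymbol_eq_one_iff hθ).mpr one_pos

/-- The symbol of `−1` at a real place with `θ < 0` is `−1` (restatement of (R2) for the symbol). -/
theorem realHilbertSymbol_neg_one_eq_neg_one {θ : ℝ} (hθ : θ < 0) : realHilbertSymbol (-1) θ = -1 :=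
  (realHilbertSymbol_eq_neg_one_iff hθ (by norm_num)).mpr (by norm_num)

/-- Lemma B1.4.2's sign bookkeeping at a real place: if `δ = det H_W` is the determinant of a hermitian form of
signature (2,1) at τ then `τ(δ) < 0`, and its real symbol with `θ` is `−1`; with signature (3,0) at τ′, `τ′(δ) > 0`
and the symbol is `+1`. Packaged as: for `δ ≠ 0`, `realHilbertSymbol δ θ = −1 ↔ δ < 0` and `= 1 ↔ 0 < δ`. -/
theorem realHilbertSymbol_sign_dichotomy {δ θ : ℝ} (hθ : θ < 0) (hδ : δ ≠ 0) :
    (realHilbertSymbol δ θ = -1 ↔ δ < 0) ∧ (realHilbertSymbol δ θ = 1 ↔ 0 < δ) :=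
  ⟨realHilbertSymbol_eq_neg_one_iff hθ hδ, realHilbertSymbol_eq_one_iff hθ⟩

/-- The real-place part of the parity count `φ(D) = (−1)^{|T|}` of Lemma B1.2.5: for a finite family of real places
`i` with `θ_i < 0` and non-zero coordinates `α_i`, the product of the real Hilbert symbols `(α_i, θ_i)` equals
`(−1)^{#{i : α_i < 0}}` — each negative coordinate contributes exactly one factor `−1`. (For a totally positive
definite form every `α_i = D_{τ_i} > 0`, so the real places contribute `+1`; for the τ-nearby space exactly one
coordinate is negative, contributing `−1`.) -/
theorem prod_realHilbertSymbol_eq_neg_one_pow {ι : Type*} [Fintype ι] {α θ : ι → ℝ}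
    (hθ : ∀ i, θ i < 0) (hα : ∀ i, α i ≠ 0) :
    ∏ i, realHilbertSymbol (α i) (θ i) = (-1) ^ (Finset.univ.filter (fun i => α i < 0)).card := by
  have h : ∀ i, realHilbertSymbol (α i) (θ i) = if α i < 0 then (-1 : ℤˣ) else 1 := by
    intro i
    by_cases hi : α i < 0
    · rw [if_pos hi]
      exact (realHilbertSymbol_eq_neg_one_iff (hθ i) (hα i)).mpr hi
    · rw [if_neg hi]
      exact (realHilbertSymbol_eq_one_iff (hθ i)).mpr (lt_of_le_of_ne (not_lt.mp hi) (hα i).symm)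
  simp_rw [h]
  rw [Finset.prod_ite, Finset.prod_const, Finset.prod_const_one, mul_one]
  congr 1

/-- Specialisation: a totally positive definite real family (`0 < α_i` everywhere) has real symbol product `+1`. -/
theorem prod_realHilbertSymbol_eq_one_of_pos {ι : Type*} [Fintype ι] {α θ : ι → ℝ}
    (hθ : ∀ i, θ i < 0) (hα : ∀ i, 0 < α i) :
    ∏ i, realHilbertSymbol (α i) (θ i) = 1 := by
  rw [Finset.prod_eq_one]
  intro i _
  exact (realHilbertSymbol_eq_one_iff (hθ i)).mpr (hα i)

end Summit.Ventures.HodgeRepro2.T4RealPlace
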